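import Mathlib
import Summits.ResolutionOfSingularities.ResolutionOfSingularities.Theorems.RadicialJungCleanModelsBranchDescent
import Summits.ResolutionOfSingularities.ResolutionOfSingularities.Theorems.RadicialJungCleanModelsBirthAxisLeaf
import Literature.AlgebraicGeometry.Resolution.AdicCompletionRegular
import HarnessLib

/-!
# Route `RadicialJung`, crux `CleanModels` (stmt-ResolutionOfSingularities-15917), line `Sketch` rev 35, stub 6 `stub_cleanProp44` (X44c),
# `τ = 1` residual, (B5″): THE LEAF CLASS OF A STRAIGHTENED BIRTHS CHAIN IS ALGEBRAIC ALONG ITS AXIS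

Seat decomp-res-hand-2 g14 (structural hand).  Composition of ✓ `births_axis_leaf` (hand-2 g13: formal axis `𝔓` of a straightened births
chain, formal leaf `t + w ĝ^p ∈ 𝔓`, algebraic `Σ_μ`-curve `𝔮 = 𝔓 ∩ R` below it) with the branch-descent brick ✓
`exists_add_mul_pow_mem_under_of_mem_minimalPrimes` (this seat, `…BranchDescent.lean`).  The brick wants `𝔓` MINIMAL over `𝔮 R^`; this
file supplies that from HEIGHTS along the flat map `R → R^` (`ht 𝔓 = ht 𝔮 + ht(𝔓 / 𝔮 R^)`, Mathlib
`Ideal.height_eq_height_add_of_liesOver_of_hasGoingDown`): in the births setting `ht 𝔓 ≤ 2` (`𝔓 ≠ 𝔪̂`, `dim R^ = dim R = 3`) and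
`ht 𝔮 ≥ 2` (`J ⊆ 𝔮` with `ht J ≥ 2` — the codimension-`≥ 2` support of the idealistic exponent in X44c).

* `mem_minimalPrimes_of_height_le_height_under` — `A → B` flat, Noetherian: a prime `P` of `B` with `ht P ≤ ht (P ∩ A)` is minimal over
  `(P ∩ A) B`.
* `le_under_of_map_le_pow_maximalIdeal` — `J R_𝔮 ⊆ (𝔮 R_𝔮)^μ`, `μ ≥ 1` ⟹ `J ⊆ 𝔮`.
* `height_le_of_ne_maximalIdeal_adicCompletion` — a non-maximal prime of the completion of a `d + 1`-dimensional Noetherian local ring has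
  height `≤ d`.
* `births_axis_leaf_descent` — **(B5″) in the kernel up to the dictionary**: for a regular local G-ring `(R, 𝔪)` of dimension `3` and
  characteristic `p` with r.s.p. `(u, t, u₂)`, a convergent sequence `g_N` (`g_0 = 0`), corrected parameters `z₂⁽ᴺ⁾ = t + w g_N^p`, `z₃⁽ᴺ⁾`
  (rates `𝔪^{N+2}`), and an ideal `J` of height `≥ 2` with `J ⊆ (z₂⁽ᴺ⁾, z₃⁽ᴺ⁾)^μ + (u^{N+1})` for all `N` (`μ ≥ 1`): there is a prime
  `𝔮 ≠ 𝔪` of `R` with `u ∉ 𝔮`, `J R_𝔮 ⊆ (𝔮 R_𝔮)^μ` (an algebraic, non-exceptional `Σ_μ`-curve through the chain point) and `a, b ∈ R`,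
  `b ∉ 𝔮`, with `t b^p + w a^p ∈ 𝔮` (the leaf class `−t/w` is a `p`-th power in `κ(𝔮)`: the curve lies on an ALGEBRAIC representative
  of the leaf).

Honest framing: OURS; the strategy-order contradiction («a `W`-invariant `Σ_μ`-curve through `c` is an `o = 1` curve, blown up before any
insertion at `c`») is dictionary business (memo 4e O1); nothing here proves the hypotheses of ✓ `cleanProp44_of_tauOneResidual`, X44c, any
case of `CleanModels`, or resolution of singularities in characteristic `p`. [cite: CossartPiltant2008, Prop. 4.4 (proof, p. 11)]
[cite: Matsumura1987, §15 Thm. 15.1; §32 p. 256]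
-/

set_option linter.dupNamespace false -- mandated namespace of this single-conjunct summit

noncomputable section

open IsLocalRing
open Literature.AlgebraicGeometry.Resolution

namespace Summit.ResolutionOfSingularities.ResolutionOfSingularities.Theorems.RadicialJung.CleanModels

universe u v

/-! ## §1 Minimality over an extended prime from heights, along a flat homomorphism -/

section Heights

/-- **`A → B` flat, `A`, `B` Noetherian, `P` a prime of `B` with `ht P ≤ ht (P ∩ A)`: then `P` is a minimal prime over `(P ∩ A) B`**
(`ht P = ht (P ∩ A) + ht (P / (P ∩ A) B)` by going-down, so the last height is `0`). [cite: Matsumura1987, §15 Thm. 15.1 (ii), p. 116] -/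
theorem mem_minimalPrimes_of_height_le_height_under {A : Type u} {B : Type v} [CommRing A] [CommRing B] [Algebra A B]
    [IsNoetherianRing A] [IsNoetherianRing B] [Module.Flat A B] (P : Ideal B) [P.IsPrime]
    (hle : P.height ≤ (P.under A).height) :
    P ∈ ((P.under A).map (algebraMap A B)).minimalPrimes := by
  haveI : Algebra.HasGoingDown A B := Algebra.HasGoingDown.of_flat
  have h := Ideal.height_eq_height_add_of_liesOver_of_hasGoingDown (P.under A) P
  have hker : (P.under A).map (algebraMap A B) ≤ P := Ideal.map_comap_le
  haveI hprime : (P.map (Ideal.Quotient.mk ((P.under A).map (algebraMap A B)))).IsPrime :=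
    Ideal.map_isPrime_of_surjective Ideal.Quotient.mk_surjective (by rwa [Ideal.mk_ker])
  -- finiteness of the heights involved
  have hfinP : P.height ≠ ⊤ := Ideal.height_ne_top_of_isPrime
  have hfinp : (P.under A).height ≠ ⊤ := Ideal.height_ne_top_of_isPrime
  have hx : (P.map (Ideal.Quotient.mk ((P.under A).map (algebraMap A B)))).height ≤ P.height := by
    rw [h]; exact le_add_self
  obtain ⟨n, hn⟩ := ENat.ne_top_iff_exists.mp hfinP
  obtain ⟨m, hm⟩ := ENat.ne_top_iff_exists.mp hfinp
  obtain ⟨k, hk⟩ := ENat.ne_top_iff_exists.mp (ne_top_of_le_ne_top hfinP hx)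
  rw [← hn, ← hm, ← hk] at h
  rw [← hn, ← hm] at hle
  have h' : n = m + k := by exact_mod_cast h
  have hle' : n ≤ m := by exact_mod_cast hle
  have h0 : (P.map (Ideal.Quotient.mk ((P.under A).map (algebraMap A B)))).height = 0 := by
    rw [← hk]; exact_mod_cast (show k = 0 by omega)
  -- height zero ⟹ minimal prime of the quotient ⟹ `P` minimal over `(P ∩ A) B`
  rw [Ideal.height_eq_zero_iff] at h0
  rw [Ideal.minimalPrimes_eq_comap]
  refine ⟨_, h0, ?_⟩
  rw [Ideal.comap_map_of_surjective _ Ideal.Quotient.mk_surjective, ← RingHom.ker_eq_comap_bot, Ideal.mk_ker,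
    sup_eq_left.mpr hker]

end Heights

/-! ## §2 Two small facts -/

section Small

/-- `J R_𝔮 ⊆ (𝔮 R_𝔮)^μ` with `μ ≥ 1` forces `J ⊆ 𝔮`. [folklore] -/
theorem le_of_map_le_pow_maximalIdeal_localization {R : Type u} [CommRing R] (𝔮 : Ideal R) [𝔮.IsPrime] (J : Ideal R)
    {μ : ℕ} (hμ : 1 ≤ μ)
    (hJ : J.map (algebraMap R (Localization.AtPrime 𝔮)) ≤ maximalIdeal (Localization.AtPrime 𝔮) ^ μ) : J ≤ 𝔮 := by
  intro x hx
  have h1 : algebraMap R (Localization.AtPrime 𝔮) x ∈ maximalIdeal (Localization.AtPrime 𝔮) :=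
    Ideal.pow_le_self (Nat.one_le_iff_ne_zero.mp hμ) (hJ (Ideal.mem_map_of_mem _ hx))
  exact (IsLocalization.AtPrime.to_map_mem_maximal_iff (Localization.AtPrime 𝔮) 𝔮 x).mp h1

/-- In the completion `R^` of a Noetherian local ring `R` of dimension `d + 1`, a prime `𝔓 ≠ 𝔪̂` has height `≤ d`
(`dim R^ = dim R`, ✓ `ringKrullDim_adicCompletion`). [cite: Matsumura1987, §15 Thm. 15.1] -/
theorem height_le_of_ne_maximalIdeal_adicCompletion {R : Type u} [CommRing R] [IsLocalRing R] [IsNoetherianRing R]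
    {d : ℕ} (hdim : ringKrullDim R = (d + 1 : ℕ))
    (𝔓 : Ideal (AdicCompletion (maximalIdeal R) R)) [𝔓.IsPrime] (hne : 𝔓 ≠ maximalIdeal (AdicCompletion (maximalIdeal R) R)) :
    𝔓.height ≤ d := by
  haveI : IsNoetherianRing (AdicCompletion (maximalIdeal R) R) := isNoetherianRing_adicCompletion_maximalIdeal R
  have hlt : 𝔓 < maximalIdeal (AdicCompletion (maximalIdeal R) R) :=
    lt_of_le_of_ne (IsLocalRing.le_maximalIdeal Ideal.IsPrime.ne_top') hne
  have h1 := Ideal.height_strict_mono_of_isPrime_of_isPrime hlt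
  have h2 : ((maximalIdeal (AdicCompletion (maximalIdeal R) R)).height : WithBot ℕ∞) = (d + 1 : ℕ) := by
    rw [IsLocalRing.maximalIdeal_height_eq_ringKrullDim, ringKrullDim_adicCompletion, hdim]
  have h2' : (maximalIdeal (AdicCompletion (maximalIdeal R) R)).height = (d + 1 : ℕ) := by exact_mod_cast h2
  rw [h2'] at h1
  have hfin : 𝔓.height ≠ ⊤ := Ideal.height_ne_top_of_isPrime
  obtain ⟨n, hn⟩ := ENat.ne_top_iff_exists.mp hfin
  rw [← hn] at h1 ⊢
  have h1' : n < d + 1 := by exact_mod_cast h1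
  exact_mod_cast (show n ≤ d by omega)

end Small

/-! ## §3 (B5″): the leaf class of a straightened births chain is algebraic along its axis -/

/-- **(B5″) in the kernel, up to the dictionary.**  See the module docstring.
[cite: CossartPiltant2008, Prop. 4.4 (proof, p. 11)] [cite: Matsumura1987, §32 p. 256] -/
theorem births_axis_leaf_descent {R : Type u} [CommRing R] [IsRegularLocalRing R] (hG : IsGRing R) (p : ℕ) [Fact p.Prime]
    [CharP R p] (u t u₂ w : R) (hgen : Ideal.span {u, t, u₂} = maximalIdeal R) (hdim : ringKrullDim R = 3)
    (g : ℕ → R) (hg0 : g 0 = 0) (hg : ∀ n, g (n + 1) - g n ∈ maximalIdeal R ^ n)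
    (hz₂ : ∀ n, (t + w * g (n + 1) ^ p) - (t + w * g n ^ p) ∈ maximalIdeal R ^ (n + 2))
    (z₃ : ℕ → R) (hz₃ : ∀ n, z₃ (n + 1) - z₃ n ∈ maximalIdeal R ^ (n + 2)) (h0₃ : z₃ 0 = u₂)
    (J : Ideal R) (μ : ℕ) (hμ : 1 ≤ μ) (hJ2 : 2 ≤ J.height)
    (hJ : ∀ N, J ≤ Ideal.span {t + w * g N ^ p, z₃ N} ^ μ ⊔ Ideal.span {u ^ (N + 1)}) :
    ∃ (𝔮 : Ideal R) (_ : 𝔮.IsPrime), 𝔮 ≠ maximalIdeal R ∧ u ∉ 𝔮 ∧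
      J.map (algebraMap R (Localization.AtPrime 𝔮)) ≤ maximalIdeal (Localization.AtPrime 𝔮) ^ μ ∧
      ∃ a b : R, b ∉ 𝔮 ∧ t * b ^ p + w * a ^ p ∈ 𝔮 := by
  haveI : IsNoetherianRing R := inferInstance
  haveI : IsNoetherianRing (AdicCompletion (maximalIdeal R) R) := isNoetherianRing_adicCompletion_maximalIdeal R
  obtain ⟨𝔓, hprime, hne, -, hu, hleaf, hq𝔪, hJq⟩ :=
    births_axis_leaf hG p (Fact.out : p.Prime).pos u t u₂ w hgen hdim g hg0 hg hz₂ z₃ hz₃ h0₃ J μ hJ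
  haveI := hprime
  -- `J ⊆ 𝔮`, so `ht 𝔮 ≥ 2`; `ht 𝔓 ≤ 2` as `𝔓 ≠ 𝔪̂` in the 3-dimensional `R^`; hence `𝔓` is minimal over `𝔮 R^`
  have hJle : J ≤ 𝔓.under R := le_of_map_le_pow_maximalIdeal_localization (𝔓.under R) J hμ hJq
  have h𝔮2 : (2 : ℕ∞) ≤ (𝔓.under R).height := le_trans hJ2 (Ideal.height_mono hJle)
  have h𝔓2 : 𝔓.height ≤ (2 : ℕ) :=
    height_le_of_ne_maximalIdeal_adicCompletion (d := 2) (by rw [hdim]; norm_num) 𝔓 hne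
  have hmin : 𝔓 ∈ ((𝔓.under R).map (algebraMap R (AdicCompletion (maximalIdeal R) R))).minimalPrimes :=
    mem_minimalPrimes_of_height_le_height_under 𝔓 (le_trans h𝔓2 (by exact_mod_cast h𝔮2))
  obtain ⟨a, b, hb, hab⟩ := exists_add_mul_pow_mem_under_of_mem_minimalPrimes hG p 𝔓 hmin hleaf
  refine ⟨𝔓.under R, inferInstance, hq𝔪, fun hu' => hu ?_, hJq, a, b, hb, hab⟩
  exact hu'

end Summit.ResolutionOfSingularities.ResolutionOfSingularities.Theorems.RadicialJung.CleanModels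

end
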